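import Summits.PneNP.PneNP.Theses.SymmetryBudget
import Literature.Computability.Complexity.SymmetricCircuit
import Literature.Computability.Complexity.FPStringBricks
import Literature.Computability.Complexity.CircuitClassesUniformProofs
import Literature.Computability.Complexity.CircuitClassesProofs
import Literature.Computability.Complexity.DeMorganSimulation

/-!
# `WindowBarrier` (stmt-PneNP-2145) — negative-side support II: without the SYMMETRY requirement
# the crux is false (`P ⊆ P/poly` for graph slices)

Route `PneNP/SymmetryBudget`, crux rank 4 (`Summit.PneNP.PneNP.Theses.SymmetryBudget.WindowBarrier`;
inline `HasSym`/`Bud` = `HasSymCircuit tcBasis` / `pointStabiliserBudget` of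
`Literature.Computability.Complexity.SymmetricCircuit`, by `Iff.rfl`). Sorry-free, by the crux
disprover (cdisprove seat); companion of `Negative/InvarianceAndBridge.lean`.

* `windowBarrier_false_at_budget_zero` — the crux with its SYMMETRY requirement deleted (budget
  `0`: `Bud(m,0) = {1}`, every circuit is symmetric) is FALSE: every `L ∈ P` has polynomial-size
  threshold circuits for its graph slices (`slice_circuit_of_mem_P`, from the tree's
  `P_subset_PPoly_holds`, the `CktSize` composition calculus — the code map `x ↦ encode ⟨m, G_x⟩`
  costs one `B₂` gate per code bit — and `CktSize.deMorgan_of_B2`). So any proof of the crux uses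
  the symmetry demand essentially ("`_false_without_symmetry`"); with the support item `Symmetrise`
  the same refutation reaches every budget with `g! ≤ poly`.

* `windowBarrierAt_false_of_factorial_le` — given the support item `Symmetrise`, the same
  refutation reaches every budget `g` with `(g m)! ≤ poly(m)` (the route's "bridge edge", checked).

Together with the companion file: without INVARIANCE the crux is trivially true, without SYMMETRY
it is false; its content is the conjunction at the window budget `⌊log₂ m⌋`, strictly between the
`g! ≤ poly` bridge edge (this file + `Symmetrise`) and the `g ≥ ⌊log₂ m⌋²` support-theorem edge
(`PolylogBarrier`).
-/

namespace Summit.PneNP.WindowBarrier.Negative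

open scoped Classical
open Filter Literature.Computability.Complexity Summit.PneNP.PneNP.Theses.SymmetryBudget
open _root_.Computability

section BudgetZero

/-- Length of a graph code. [folklore] -/
theorem length_encode_graph (m : ℕ) (G : SimpleGraph (Fin m)) :
    (encodingGraph.encode ⟨m, G⟩).length = 2 * (encodeNat m).length + 2 + m * m := by
  rw [encodingGraph_encode, length_boolPair]
  simp [encodingGraphFin, encodingBitVec]

/-- The (input-independent) length of the code of an `m`-vertex graph. -/
def codeLen (m : ℕ) : ℕ := 2 * (encodeNat m).length + 2 + m * m

/-- `|encodeNat m| ≤ m`. [folklore] -/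
theorem length_encodeNat_le (m : ℕ) : (encodeNat m).length ≤ m := by
  induction m with
  | zero => exact le_of_eq (by rfl)
  | succ m ih => exact (length_encodeNat_succ_le m).trans (by omega)

/-- `codeLen m ≤ (m + 2)^2`. [folklore] -/
theorem codeLen_le (m : ℕ) : codeLen m ≤ (m + 2) ^ 2 := by
  have := length_encodeNat_le m
  unfold codeLen
  nlinarith

/-- The code map `x ↦ encode ⟨m, G_x⟩` as a bit-vector-valued function. -/
noncomputable def codeFn (m : ℕ) (x : Fin m × Fin m → Bool) (k : Fin (codeLen m)) : Bool :=
  (encodingGraph.encode ⟨m, (SimpleGraph.fromRel fun u v => x (u, v) = true)⟩).getD k false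

/-- The code map lists the code. [folklore] -/
theorem ofFn_codeFn (m : ℕ) (x : Fin m × Fin m → Bool) :
    List.ofFn (codeFn m x) =
      encodingGraph.encode ⟨m, (SimpleGraph.fromRel fun u v => x (u, v) = true)⟩ := by
  apply List.ext_getElem
  · rw [List.length_ofFn, length_encode_graph]; rfl
  · intro k h1 h2
    rw [List.getElem_ofFn]
    show (encodingGraph.encode ⟨m, (SimpleGraph.fromRel fun u v => x (u, v) = true)⟩).getD k false = _
    rw [List.getD_eq_getElem?_getD, List.getElem?_eq_getElem h2, Option.getD_some]

/-- Every code bit is either constant in `x` (header, diagonal, padding) or the symmetrised entry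
`x(i,j) ∨ x(j,i)` of one off-diagonal pair. [folklore] -/
theorem codeFn_bit (m : ℕ) (k : Fin (codeLen m)) :
    (∃ b, ∀ x, codeFn m x k = b) ∨
      (∃ i j : Fin m, i ≠ j ∧ ∀ x, codeFn m x k = (x (i, j) || x (j, i))) := by
  have hsplit : ∀ (G : SimpleGraph (Fin m)), encodingGraph.encode ⟨m, G⟩ =
      boolPair (encodeNat m) [] ++ (encodingGraphFin m).encode G := by
    intro G
    rw [encodingGraph_encode]
    simp [boolPair]
  by_cases hk : (k : ℕ) < (boolPair (encodeNat m) []).length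
  · refine Or.inl ⟨(boolPair (encodeNat m) []).getD k false, fun x => ?_⟩
    show (encodingGraph.encode ⟨m, (SimpleGraph.fromRel fun u v => x (u, v) = true)⟩).getD k false = _
    rw [hsplit, List.getD_append _ _ _ _ hk]
  · rw [not_lt] at hk
    set k' : ℕ := (k : ℕ) - (boolPair (encodeNat m) []).length with hk'
    have hbody : ∀ x, codeFn m x k =
        ((encodingGraphFin m).encode (SimpleGraph.fromRel fun u v => x (u, v) = true)).getD k' false := by
      intro x
      show (encodingGraph.encode ⟨m, (SimpleGraph.fromRel fun u v => x (u, v) = true)⟩).getD k false = _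
      rw [hsplit, List.getD_append_right _ _ _ _ hk]
    by_cases hk2 : k' < m * m
    · set q : Fin m × Fin m := finProdFinEquiv.symm ⟨k', hk2⟩ with hq
      have hbit : ∀ x,
          (codeFn m x k = true ↔ (SimpleGraph.fromRel fun u v => x (u, v) = true).Adj q.1 q.2) := by
        intro x
        rw [hbody x]
        have hlen :
            ((encodingGraphFin m).encode (SimpleGraph.fromRel fun u v => x (u, v) = true)).length = m * m := by
          simp [encodingGraphFin, encodingBitVec]
        rw [List.getD_eq_getElem?_getD, List.getElem?_eq_getElem (by rw [hlen]; exact hk2),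
          Option.getD_some]
        simp [encodingGraphFin, encodingBitVec, List.getElem_ofFn, hq]
      by_cases hij : q.1 = q.2
      · refine Or.inl ⟨false, fun x => ?_⟩
        rw [Bool.eq_false_iff]
        intro h
        have h' := (hbit x).1 h
        rw [hij] at h'
        exact SimpleGraph.irrefl (SimpleGraph.fromRel fun u v => x (u, v) = true) h'
      · refine Or.inr ⟨q.1, q.2, hij, fun x => ?_⟩
        rw [Bool.eq_iff_iff, hbit x, SimpleGraph.fromRel_adj, Bool.or_eq_true]
        exact ⟨fun h => h.2, fun h => ⟨hij, h⟩⟩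
    · refine Or.inl ⟨false, fun x => ?_⟩
      rw [hbody x]
      have hlen :
          ((encodingGraphFin m).encode (SimpleGraph.fromRel fun u v => x (u, v) = true)).length = m * m := by
        simp [encodingGraphFin, encodingBitVec]
      exact List.getD_eq_default _ _ (by rw [hlen]; exact Nat.not_lt.1 hk2)

/-- The code map costs at most one `B₂` gate per code bit. [folklore] -/
theorem cktSize_codeFn (m : ℕ) : CktSize B2 (codeFn m) (codeLen m) := by
  have h : ∀ k : Fin (codeLen m),
      CktSize B2 (fun (x : Fin m × Fin m → Bool) (_ : Unit) => codeFn m x k) 1 := by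
    intro k
    rcases codeFn_bit m k with ⟨b, hb⟩ | ⟨i, j, -, hij⟩
    · exact (cktSize_const (Fin m × Fin m) b).congr fun x _ => (hb x).symm
    · exact (cktSize_or (i, j) (j, i)).congr fun x _ => (hij x).symm
  simpa using CktSize.pi_const h

/-- `{∧₂, ∨₂, ¬} ⊆ tcBasis`. [folklore] -/
theorem deMorganBasis_subset_tcBasis : deMorganBasis ⊆ tcBasis := by
  intro f hf
  simp only [deMorganBasis, Set.mem_insert_iff, Set.mem_singleton_iff] at hf
  refine acBasis_subset_tcBasis ?_
  rcases hf with rfl | rfl | rfl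
  · exact Or.inr (Set.mem_iUnion.2 ⟨2, Or.inl rfl⟩)
  · exact Or.inr (Set.mem_iUnion.2 ⟨2, Or.inr rfl⟩)
  · exact Or.inl rfl

/-- Evaluation of an `ℕ`-polynomial is monotone. [folklore] -/
theorem eval_mono_nat (p : Polynomial ℕ) {a b : ℕ} (h : a ≤ b) : p.eval a ≤ p.eval b := by
  induction p using Polynomial.induction_on' with
  | add p q hp hq => simpa only [Polynomial.eval_add] using Nat.add_le_add hp hq
  | monomial n c =>
    simp only [Polynomial.eval_monomial]
    exact Nat.mul_le_mul_left c (Nat.pow_le_pow_left h n)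

/-- `L.boolIndicator w = [w ∈ L]`. [folklore] -/
theorem boolIndicator_eq_decide (L : Language Bool) (w : List Bool) :
    L.boolIndicator w = decide (w ∈ L) := by
  by_cases h : w ∈ L
  · rw [(Set.mem_iff_boolIndicator (s := L) w).1 h, decide_eq_true h]
  · rw [(Set.notMem_iff_boolIndicator (s := L) w).1 h, decide_eq_false h]

/-- **`P ⊆ P/poly` for graph slices**: every `L ∈ P` has, for some polynomial `q` and every `m ≥ 1`,
a threshold circuit of size `≤ q m` computing its `m`-th graph slice `x ↦ [encode ⟨m, G_x⟩ ∈ L]`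
(Arora–Barak 2009, Thm. 6.6, via the tree facts `P_subset_PPoly_holds`, `CktSize.comp`,
`CktSize.deMorgan_of_B2`). [folklore] -/
theorem slice_circuit_of_mem_P {L : Language Bool} (hL : L ∈ Classes.P) :
    ∃ q : Polynomial ℕ, ∀ m, 1 ≤ m →
      ∃ C : Circuit (Fin m × Fin m), C.IsOver tcBasis ∧ C.size ≤ q.eval m ∧
        C.Computes fun x : Fin m × Fin m → Bool =>
          decide (encodingGraph.encode ⟨m, (SimpleGraph.fromRel fun u v => x (u, v) = true)⟩ ∈ L) := by
  have hPP : L ∈ PPoly := P_subset_PPoly_holds hL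
  simp only [PPoly, Set.mem_iUnion] at hPP
  obtain ⟨p, Cfam, hC, hDec⟩ := hPP
  refine ⟨12 * ((Polynomial.X + 2) ^ 2 + p.comp ((Polynomial.X + 2) ^ 2)) + 3, fun m hm => ?_⟩
  have h1 : CktSize B2 (fun (u : Fin (codeLen m) → Bool) (_ : Unit) => (Cfam (codeLen m)).eval u)
      (Cfam (codeLen m)).size := Circuit.cktSize_eval _ (hC _).1
  have h3 := ((cktSize_codeFn m).comp h1).deMorgan_of_B2 ((⟨0, hm⟩ : Fin m), (⟨0, hm⟩ : Fin m))
  obtain ⟨C, hB, hs, hev⟩ := (h3.basis_mono deMorganBasis_subset_tcBasis).toCircuit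
  refine ⟨C, hB, hs.trans ?_, fun x => ?_⟩
  · have hsz : (Cfam (codeLen m)).size ≤ p.eval ((m + 2) ^ 2) :=
      (hC _).2.trans (eval_mono_nat p (codeLen_le m))
    have hcl := codeLen_le m
    simp only [Polynomial.eval_add, Polynomial.eval_mul, Polynomial.eval_pow, Polynomial.eval_X,
      Polynomial.eval_comp, Polynomial.eval_ofNat]
    nlinarith
  · rw [hev x, hDec.eval_eq, ofFn_codeFn, boolIndicator_eq_decide]

/-- **`WindowBarrier` without its symmetry requirement is FALSE.** The statement below is the crux
verbatim with the budget `Nat.log 2 m` replaced by `0` (`Bud(m,0) = {1}`, so `HasSym` is plain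
circuit existence): refuted by `P ⊆ P/poly` for graph slices. Hence any proof of the crux uses the
symmetry demand `g = ⌊log₂ m⌋` essentially; with the support item `Symmetrise` (g!-sandwich) the
same refutation reaches every budget with `g! ≤ poly(m)`, i.e. the crux sits at the first budget
where it does not apply. [folklore] -/
theorem windowBarrier_false_at_budget_zero :
    ¬ ∃ L ∈ Classes.P,
        (∀ (m : ℕ), ∀ ρ ∈ pointStabiliserBudget m 0, ∀ x : Fin m × Fin m → Bool,
            (encodingGraph.encode ⟨m, SimpleGraph.fromRel fun u v =>
                (fun q : Fin m × Fin m => x (ρ q.1, ρ q.2)) (u, v) = true⟩ ∈ L ↔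
              encodingGraph.encode ⟨m, (SimpleGraph.fromRel fun u v => x (u, v) = true)⟩ ∈ L)) ∧
          ∀ p : Polynomial ℕ, ∃ᶠ m in atTop,
            ¬ HasSymCircuit tcBasis (pointStabiliserBudget m 0) (p.eval m)
              (fun x : Fin m × Fin m → Bool =>
                decide (encodingGraph.encode ⟨m, (SimpleGraph.fromRel fun u v => x (u, v) = true)⟩ ∈ L)) := by
  rintro ⟨L, hL, -, hhard⟩
  obtain ⟨q, hq⟩ := slice_circuit_of_mem_P hL
  obtain ⟨m, hno, hm⟩ := ((hhard q).and_eventually (eventually_ge_atTop 1)).exists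
  obtain ⟨C, hB, hs, hcomp⟩ := hq m hm
  refine hno ⟨C, hB, hs, ?_, hcomp⟩
  rw [pointStabiliserBudget_zero]
  exact C.isSymmetricUnder_one


/-! ### The bridge edge: given `Symmetrise`, false at every budget with `g! ≤ poly` -/

/-- `B₂` version (no basis conversion): every `L ∈ P` has poly-size `B₂`-circuits for its graph
slices (Arora–Barak 2009, Thm. 6.6 via `P_subset_PPoly_holds` and `CktSize.comp`). [folklore] -/
theorem slice_B2circuit_of_mem_P {L : Language Bool} (hL : L ∈ Classes.P) :
    ∃ q : Polynomial ℕ, ∀ m,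
      ∃ C : Circuit (Fin m × Fin m), C.IsOver B2 ∧ C.size ≤ q.eval m ∧
        C.Computes fun x : Fin m × Fin m → Bool =>
          decide (encodingGraph.encode ⟨m, (SimpleGraph.fromRel fun u v => x (u, v) = true)⟩ ∈ L) := by
  have hPP : L ∈ PPoly := P_subset_PPoly_holds hL
  simp only [PPoly, Set.mem_iUnion] at hPP
  obtain ⟨p, Cfam, hC, hDec⟩ := hPP
  refine ⟨(Polynomial.X + 2) ^ 2 + p.comp ((Polynomial.X + 2) ^ 2), fun m => ?_⟩
  have h1 : CktSize B2 (fun (u : Fin (codeLen m) → Bool) (_ : Unit) => (Cfam (codeLen m)).eval u)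
      (Cfam (codeLen m)).size := Circuit.cktSize_eval _ (hC _).1
  obtain ⟨C, hB, hs, hev⟩ := ((cktSize_codeFn m).comp h1).toCircuit
  refine ⟨C, hB, hs.trans ?_, fun x => ?_⟩
  · have hsz : (Cfam (codeLen m)).size ≤ p.eval ((m + 2) ^ 2) :=
      (hC _).2.trans (eval_mono_nat p (codeLen_le m))
    have hcl := codeLen_le m
    simp only [Polynomial.eval_add, Polynomial.eval_pow, Polynomial.eval_X, Polynomial.eval_comp,
      Polynomial.eval_ofNat]
    omega
  · rw [hev x, hDec.eval_eq, ofFn_codeFn, boolIndicator_eq_decide]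

/-- **Bridge edge (conditional on the support item `Symmetrise`).** If `Symmetrise` holds
(g!-symmetrisation of a `B₂`-circuit; elementary, the canary of the inline symmetry predicate) then
the crux statement is FALSE at every budget function `g` with `(g m)! ≤ r m` for some polynomial
`r`, i.e. for `g = O(log m / log log m)`: symmetrise the `P ⊆ P/poly` circuits. The statement below
is the crux verbatim with `Nat.log 2 m` replaced by `g m`. So the window budget `⌊log₂ m⌋`
(`g! = m^{Θ(log log m)}`) is the first scale this refutation does not reach; and a proof of the crux
pattern at any budget with `g! ≤ poly` would refute `Symmetrise`. [folklore] -/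
theorem windowBarrierAt_false_of_factorial_le (hS : Symmetrise) {g : ℕ → ℕ} (r : Polynomial ℕ)
    (hg : ∀ m, (g m).factorial ≤ r.eval m) :
    ¬ ∃ L ∈ Classes.P,
        (∀ (m : ℕ), ∀ ρ ∈ pointStabiliserBudget m (g m), ∀ x : Fin m × Fin m → Bool,
            (encodingGraph.encode ⟨m, SimpleGraph.fromRel fun u v =>
                (fun q : Fin m × Fin m => x (ρ q.1, ρ q.2)) (u, v) = true⟩ ∈ L ↔
              encodingGraph.encode ⟨m, (SimpleGraph.fromRel fun u v => x (u, v) = true)⟩ ∈ L)) ∧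
          ∀ p : Polynomial ℕ, ∃ᶠ m in atTop,
            ¬ HasSymCircuit tcBasis (pointStabiliserBudget m (g m)) (p.eval m)
              (fun x : Fin m × Fin m → Bool =>
                decide (encodingGraph.encode ⟨m, (SimpleGraph.fromRel fun u v => x (u, v) = true)⟩ ∈ L)) := by
  rintro ⟨L, hL, hinv, hhard⟩
  obtain ⟨c, hc⟩ := hS
  obtain ⟨q, hq⟩ := slice_B2circuit_of_mem_P hL
  obtain ⟨m, hno⟩ := (hhard (Polynomial.C c * (r * (q + 1)))).exists
  obtain ⟨C, hB, hs, hcomp⟩ := hq m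
  have hinv' : ∀ ρ ∈ pointStabiliserBudget m (g m), ∀ x : Fin m × Fin m → Bool,
      (fun x : Fin m × Fin m → Bool =>
          decide (encodingGraph.encode ⟨m, (SimpleGraph.fromRel fun u v => x (u, v) = true)⟩ ∈ L))
          (fun q : Fin m × Fin m => x (ρ q.1, ρ q.2)) =
        (fun x : Fin m × Fin m → Bool =>
          decide (encodingGraph.encode ⟨m, (SimpleGraph.fromRel fun u v => x (u, v) = true)⟩ ∈ L)) x :=
    fun ρ hρ x => (decide_eq_decide).2 (hinv m ρ hρ x)
  have hsym : HasSymCircuit tcBasis (pointStabiliserBudget m (g m))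
      (c * ((g m).factorial * (C.size + 1)))
      (fun x : Fin m × Fin m → Bool =>
        decide (encodingGraph.encode ⟨m, (SimpleGraph.fromRel fun u v => x (u, v) = true)⟩ ∈ L)) :=
    hc m (g m) (fun x : Fin m × Fin m → Bool =>
        decide (encodingGraph.encode ⟨m, (SimpleGraph.fromRel fun u v => x (u, v) = true)⟩ ∈ L))
      hinv' C hB hcomp
  refine hno (hsym.mono ?_)
  simp only [Polynomial.eval_mul, Polynomial.eval_C, Polynomial.eval_add, Polynomial.eval_one]
  exact Nat.mul_le_mul_left c (Nat.mul_le_mul (hg m) (by omega))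

end BudgetZero


end Summit.PneNP.WindowBarrier.Negative
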